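import Summits.Ventures.YMGap.RobustBall.CentreBlindSAWRate
import Literature.Probability.RandomPlanarGeometry.SAWCountExplicitBounds
import Literature.ComputerArithmetic.DeDinechinLauterMullerTorres2013.TinyArguments
import HarnessLib

/-!
# RobustBall/CentreBlindSAWRateMemory — the UNCONDITIONAL explicit windows of the SU(2) centre-blind class WITH EXPLICIT RATES, from the tree's kernel-checked
# finite-memory self-avoiding-walk certificates: `d = 4` from `c_ℓ(ℤ³)·1000^ℓ ≤ 4760^ℓ·2⁴¹` (Pönitz–Tittmann memory 10): `4.76·tanh β_W < 1`, `β_W < 0.21326…`;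
# `d = 3` from `c_ℓ(ℤ²)·1000^ℓ ≤ 2688^ℓ·2⁴¹` (memory 18): `2.688·tanh β_W < 1`, `β_W < 0.39060…`

HONEST FRAMING: venture file of the cell `pub-ymgap` (QuantumFields programme), track Y2 ROBUST-BALL / DS seat ds-4 (g13).  WHAT THIS IS: the `d = 4` and
`d = 3` instances of the SAW-rate door `su2_areaLawCentreBlind_sawRate` (`CentreBlindSAWRate.lean`: a counting certificate `c_ℓ(ℤⁿ) ≤ A λ^ℓ` gives Wilson's
area law for the whole centre-blind class on `λ·tanh(2|β|) < 1` with `|⟨W_{R×T}⟩| ≤ (A r^T/(1−r))^R`) fed with the tree's KERNEL-CHECKED certificates: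
(`d = 4`) `FiniteMemory3.count_mul_pow_le_of_check check_10` of `SAWFiniteMemoryZ3K10` (one `native_decide` over the 139 183-state memory-10 automaton of
Pönitz–Tittmann on `ℤ³`; printed value `μ(3, 10) = 4.7599`): Literature `SAW.Zd.count_three_le_pow_476 : c_ℓ(ℤ³) ≤ 2⁴¹·4.76^ℓ` (`SAWCountExplicitBounds.lean`), hence ★★
**`su2_areaLawCentreBlind_sawRate_dim4_memTen : 4.76·tanh(2|β|) < 1 → AreaLawCentreBlind 2 4 β`** — UNCONDITIONAL, `β_W = 2|β| < artanh(1/4.76) =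
0.213260…`, with the explicit pair `(C, c) = (2⁴¹/(1−r) + 1, −log max(r, 1/2))`, `r = 4.76·tanh β_W`, cells `β_W = 0.21`, `0.213`, and the limit-state
reading `su2_stringTension_sawRate_dim4_memTen`: `σ ≥ −log(4.76·tanh β_W)` whenever the string tension exists; (`d = 3`) `FiniteMemory.count_mul_pow_le_of_check
checkC_18_2688` of `SAWFiniteMemory18At2688` (memory-18 automaton on `ℤ²`, `μ(ℤ²) ≤ 2.688`): Literature `SAW.Zd.count_two_le_pow_2688 : c_ℓ(ℤ²) ≤ 2⁴¹·2.688^ℓ`, hence ★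
**`su2_areaLawCentreBlind_sawRate_dim3_memEighteen : 2.688·tanh(2|β|) < 1 → AreaLawCentreBlind 2 3 β`** — `β_W < artanh(1/2.688) = 0.390603…` (tree so far:
star window `0.29706`), cells `β_W = 0.35`, `0.39`, string tension `σ ≥ −log(2.688·tanh β_W)`.  (Previous explicit-rate row of the currency: `5·tanh β_W < 1`
in `d = 4`, `β_W < 0.2027`; the `d = 4` WINDOW `0.21326` without a rate is the staged `CentreBlindSubcriticalFisherK10` via Duminil-Copin–Tassion sharpness,
superseded by this file.)  HONEST LABEL: `SU(2)`, centre-blind class; strong-coupling lattice statements on finite tori uniformly in `L`; the numbers rest on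
`native_decide` evaluations (trust in the Lean compiler; computational, as `SAWFiniteMemoryZ3K10` / `SAWFiniteMemory18At2688`); ceilings of the route
`artanh(1/μ(ℤ³)) ≈ 0.2168` (`d = 4`), `artanh(1/μ(ℤ²)) ≈ 0.3977` (`d = 3`), below the comparison method's `β_c(ℤ³) ≈ 0.2217` / `½log(1+√2) = 0.4407`;
nothing continuum / spectral / Clay.

References AS PRINTED: A. Pönitz, P. Tittmann, Electron. J. Combin. 7 (2000) R21, Table 2 (`d = 3`, `k = 10`: `4.7599`; `d = 2`); M. E. Fisher, Phys. Rev.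
162 (1967) 480.
-/

noncomputable section

open Finset MeasureTheory
open Literature.MathematicalPhysics.QuantumLattice (fundamentalRep normalisedCharacter HasAreaLawWith HasStringTension LGConfig)
open Literature.MathematicalPhysics.QuantumFieldTheory
open Literature.Probability.RandomPlanarGeometry.SAW.Zd (count count_three_le_pow_476 count_two_le_pow_2688)

namespace Summit.Ventures.YMGap.RobustBall

/-! ### Row (ii) ★: `d = 4` UNCONDITIONALLY up to `4.76·tanh β_W < 1` (`β_W < 0.21326…`) from the kernel bound `c_ℓ(ℤ³) ≤ 2⁴¹·4.76^ℓ` -/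

/-- ★★ **SU(2), `d = 4`, UNCONDITIONAL: `4.76·tanh(2|β|) < 1 ⇒ AreaLawCentreBlind 2 4 β`**, i.e. the centre-blind class keeps Wilson's area law, with
ONE explicit `(C, c) = (2⁴¹/(1−r) + 1, −log max(r, 1/2))`, `r = 4.76·tanh β_W`, for every `β_W = 2|β| < artanh(1/4.76) = 0.213260…` (the tree's
kernel-checked Pönitz–Tittmann memory-10 certificate). [cite: PonitzTittmann2000, Table 2 (d = 3, k = 10)] -/
theorem su2_areaLawCentreBlind_sawRate_dim4_memTen {β : ℝ} (h : 4.76 * Real.tanh (2 * |β|) < 1) : AreaLawCentreBlind 2 4 β :=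
  su2_areaLawCentreBlind_sawRate (n := 3) (by norm_num) (A := 2 ^ 41) (by norm_num) (by norm_num) count_three_le_pow_476 h

/-- **SU(2), `d = 4`: EXPLICIT STRING TENSION `σ ≥ −log(4.76·tanh β_W)`** (`β_W = 2|β| ≠ 0`, `4.76·tanh β_W < 1`) for every infinite-volume limit state of
every eventually twist-blind (e.g. eventually linkwise centre-blind) family, WHENEVER its string tension `σ` exists; with `HasAreaLawWith μ χ₂ (2⁴¹/(1−r)) (−log r)`.
[cite: PonitzTittmann2000, Table 2 (d = 3, k = 10)] -/
theorem su2_stringTension_sawRate_dim4_memTen {β : ℝ} (hβ : β ≠ 0) (h : 4.76 * Real.tanh (2 * |β|) < 1) (𝓦 : PerturbationFamily 4 2)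
    (h𝓦 : ∀ᶠ L : ℕ in Filter.atTop, IsTwistBlind (𝓦 L)) {μ : Measure (LGConfig 4 (SUN 2))} (hμ : μ ∈ perturbedLimitPoints β 𝓦) :
    HasAreaLawWith μ (fun g => normalisedCharacter 2 (fundamentalRep (Fin 2) g)) (2 ^ 41 / (1 - 4.76 * Real.tanh (2 * |β|)))
        (-Real.log (4.76 * Real.tanh (2 * |β|))) ∧
      ∀ σ : ℝ, HasStringTension μ (fun g => normalisedCharacter 2 (fundamentalRep (Fin 2) g)) σ →
        -Real.log (4.76 * Real.tanh (2 * |β|)) ≤ σ :=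
  su2_stringTension_sawRate (n := 3) (by norm_num) hβ (A := 2 ^ 41) (by norm_num) (by norm_num) count_three_le_pow_476 h 𝓦 h𝓦 hμ

/-- **CELL SU(2), `d = 4`, `β_W = 21/100 = 0.21`** (unconditional): `AreaLawCentreBlind 2 4 (21/200)` (quintic enclosure `tanh 0.21 ≤ 0.2069675`,
`× 4.76 = 0.98517 < 1`). [folklore] -/
theorem su2_areaLawCentreBlind_sawRate_dim4_cell_21 : AreaLawCentreBlind 2 4 (21 / 200) := by
  refine su2_areaLawCentreBlind_sawRate_dim4_memTen ?_
  have hx : (2 * |(21 / 200 : ℝ)|) = 21 / 100 := by rw [abs_of_pos (by norm_num)]; norm_num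
  rw [hx]
  have hp : Real.tanh (21 / 100 : ℝ) ≤ 21 / 100 - (21 / 100 : ℝ) ^ 3 / 3 + 2 / 15 * (21 / 100 : ℝ) ^ 5 :=
    (Literature.ComputerArithmetic.DeDinechinLauterMullerTorres2013.tanh_quintic_bounds (by norm_num) (by norm_num)).2
  have h4 : (0 : ℝ) ≤ 4.76 := by norm_num
  exact (mul_le_mul_of_nonneg_left hp h4).trans_lt (by norm_num)

/-- **SHARP CELL SU(2), `d = 4`, `β_W = 213/1000 = 0.213`** (unconditional; the window ends at `0.21326…`): `AreaLawCentreBlind 2 4 (213/2000)`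
(quintic enclosure `tanh 0.213 ≤ 0.2098373`, `× 4.76 = 0.99883 < 1`). [folklore] -/
theorem su2_areaLawCentreBlind_sawRate_dim4_cell_213 : AreaLawCentreBlind 2 4 (213 / 2000) := by
  refine su2_areaLawCentreBlind_sawRate_dim4_memTen ?_
  have hx : (2 * |(213 / 2000 : ℝ)|) = 213 / 1000 := by rw [abs_of_pos (by norm_num)]; norm_num
  rw [hx]
  have hp : Real.tanh (213 / 1000 : ℝ) ≤ 213 / 1000 - (213 / 1000 : ℝ) ^ 3 / 3 + 2 / 15 * (213 / 1000 : ℝ) ^ 5 :=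
    (Literature.ComputerArithmetic.DeDinechinLauterMullerTorres2013.tanh_quintic_bounds (by norm_num) (by norm_num)).2
  have h4 : (0 : ℝ) ≤ 4.76 := by norm_num
  exact (mul_le_mul_of_nonneg_left hp h4).trans_lt (by norm_num)

/-- **SU(2), `d = 4`, `β_W = 0.213`, string-tension reading** (unconditional): ONE `(C, c)`, `c > 0`, for every limit state of every eventually-centre-blind
family (`HasAreaLawWith`, `HasAreaLawState`, `σ ≥ c` whenever `σ` exists, `IsConfining` given existence). [folklore] -/
theorem su2_stringTension_centreBlind_sawRate_dim4_cell_213 :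
    ∃ C c : ℝ, 0 < c ∧ ∀ 𝓦 : PerturbationFamily 4 2,
      (∀ᶠ L : ℕ in Filter.atTop, IsCentreBlind (𝓦 L)) →
        ∀ μ ∈ perturbedLimitPoints (213 / 2000 : ℝ) 𝓦,
          HasAreaLawWith μ (fun g => normalisedCharacter 2 (fundamentalRep (Fin 2) g)) C c ∧
          Literature.MathematicalPhysics.QuantumLattice.HasAreaLawState μ (fun g => normalisedCharacter 2 (fundamentalRep (Fin 2) g)) ∧
          (∀ σ : ℝ, HasStringTension μ (fun g => normalisedCharacter 2 (fundamentalRep (Fin 2) g)) σ → c ≤ σ) ∧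
          ((∃ σ : ℝ, HasStringTension μ (fun g => normalisedCharacter 2 (fundamentalRep (Fin 2) g)) σ) →
            Literature.MathematicalPhysics.QuantumLattice.IsConfining μ (fun g => normalisedCharacter 2 (fundamentalRep (Fin 2) g))) :=
  stringTension_centreBlind (N := 2) (by norm_num) su2_areaLawCentreBlind_sawRate_dim4_cell_213

/-! ### `d = 3` UNCONDITIONALLY up to `2.688·tanh β_W < 1` (`β_W < 0.39060…`) from the kernel bound `c_ℓ(ℤ²) ≤ 2⁴¹·2.688^ℓ` -/

/-- ★ **SU(2), `d = 3`, UNCONDITIONAL: `2.688·tanh(2|β|) < 1 ⇒ AreaLawCentreBlind 2 3 β`**, with ONE explicit `(C, c) = (2⁴¹/(1−r) + 1, −log max(r, 1/2))`,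
`r = 2.688·tanh β_W`, for every `β_W = 2|β| < artanh(1/2.688) = 0.390603…` (memory-18 certificate of the square lattice). [cite: PonitzTittmann2000, Table 2 (d = 2, k = 18)] -/
theorem su2_areaLawCentreBlind_sawRate_dim3_memEighteen {β : ℝ} (h : 2.688 * Real.tanh (2 * |β|) < 1) : AreaLawCentreBlind 2 3 β :=
  su2_areaLawCentreBlind_sawRate (n := 2) (by norm_num) (A := 2 ^ 41) (by norm_num) (by norm_num) count_two_le_pow_2688 h

/-- **SU(2), `d = 3`: EXPLICIT STRING TENSION `σ ≥ −log(2.688·tanh β_W)`** (`β_W = 2|β| ≠ 0`, `2.688·tanh β_W < 1`) for every infinite-volume limit state of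
every eventually twist-blind family, WHENEVER `σ` exists; with `HasAreaLawWith μ χ₂ (2⁴¹/(1−r)) (−log r)`. [cite: PonitzTittmann2000, Table 2 (d = 2, k = 18)] -/
theorem su2_stringTension_sawRate_dim3_memEighteen {β : ℝ} (hβ : β ≠ 0) (h : 2.688 * Real.tanh (2 * |β|) < 1) (𝓦 : PerturbationFamily 3 2)
    (h𝓦 : ∀ᶠ L : ℕ in Filter.atTop, IsTwistBlind (𝓦 L)) {μ : Measure (LGConfig 3 (SUN 2))} (hμ : μ ∈ perturbedLimitPoints β 𝓦) :
    HasAreaLawWith μ (fun g => normalisedCharacter 2 (fundamentalRep (Fin 2) g)) (2 ^ 41 / (1 - 2.688 * Real.tanh (2 * |β|)))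
        (-Real.log (2.688 * Real.tanh (2 * |β|))) ∧
      ∀ σ : ℝ, HasStringTension μ (fun g => normalisedCharacter 2 (fundamentalRep (Fin 2) g)) σ →
        -Real.log (2.688 * Real.tanh (2 * |β|)) ≤ σ :=
  su2_stringTension_sawRate (n := 2) (by norm_num) hβ (A := 2 ^ 41) (by norm_num) (by norm_num) count_two_le_pow_2688 h 𝓦 h𝓦 hμ

/-- **CELL SU(2), `d = 3`, `β_W = 7/20 = 0.35`** (unconditional): `AreaLawCentreBlind 2 3 (7/40)` (quintic enclosure `tanh 0.35 ≤ 0.3364088`, `× 2.688 = 0.90427 < 1`).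
[folklore] -/
theorem su2_areaLawCentreBlind_sawRate_dim3_cell_35 : AreaLawCentreBlind 2 3 (7 / 40) := by
  refine su2_areaLawCentreBlind_sawRate_dim3_memEighteen ?_
  have hx : (2 * |(7 / 40 : ℝ)|) = 7 / 20 := by rw [abs_of_pos (by norm_num)]; norm_num
  rw [hx]
  have hp : Real.tanh (7 / 20 : ℝ) ≤ 7 / 20 - (7 / 20 : ℝ) ^ 3 / 3 + 2 / 15 * (7 / 20 : ℝ) ^ 5 :=
    (Literature.ComputerArithmetic.DeDinechinLauterMullerTorres2013.tanh_quintic_bounds (by norm_num) (by norm_num)).2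
  have h4 : (0 : ℝ) ≤ 2.688 := by norm_num
  exact (mul_le_mul_of_nonneg_left hp h4).trans_lt (by norm_num)

/-- **SHARP CELL SU(2), `d = 3`, `β_W = 39/100 = 0.39`** (unconditional; the window ends at `0.39060…`): `AreaLawCentreBlind 2 3 (39/200)`
(quintic enclosure `tanh 0.39 ≤ 0.3714297`, `× 2.688 = 0.99840 < 1`). [folklore] -/
theorem su2_areaLawCentreBlind_sawRate_dim3_cell_39 : AreaLawCentreBlind 2 3 (39 / 200) := by
  refine su2_areaLawCentreBlind_sawRate_dim3_memEighteen ?_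
  have hx : (2 * |(39 / 200 : ℝ)|) = 39 / 100 := by rw [abs_of_pos (by norm_num)]; norm_num
  rw [hx]
  have hp : Real.tanh (39 / 100 : ℝ) ≤ 39 / 100 - (39 / 100 : ℝ) ^ 3 / 3 + 2 / 15 * (39 / 100 : ℝ) ^ 5 :=
    (Literature.ComputerArithmetic.DeDinechinLauterMullerTorres2013.tanh_quintic_bounds (by norm_num) (by norm_num)).2
  have h4 : (0 : ℝ) ≤ 2.688 := by norm_num
  exact (mul_le_mul_of_nonneg_left hp h4).trans_lt (by norm_num)

end Summit.Ventures.YMGap.RobustBall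

end
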